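import Summits.Ventures.HodgeRepro2.T5RecordSphericalSpectrumFourInertPrime

/-!
# The unramified spectrum of the record's pair on `ℚ(i)` at the inert place `(7)`: `q = 7`

Tier-5 support N3 / §G-N4.2 (seat p3, gen 87). File 353 reads file 344's unramified-spectrum theorem on
`L = ℚ(ζ₄) = ℚ(i)` at every inert place `vPrime L p h2` (`p ≡ 3 (mod 4)`, `q = p`). This file is the numeral `p = 7`
(file 259's `orderOf_natCast_seven_zmod_four`, `fact_prime_seven`, `absNorm_vPrime_seven`): `q = 7`, Satake parameter
`α · (7²)⁻¹ = α / 49` — the `ℚ(i)` companion of file 351's `p = 13` on the field of record: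

* `absNorm_vPrime_seven_cast` — `N(vPrime 7) = 7` in any field `k`;
* **`exists_mulEquiv_forall_nonempty_equiv_inertSphericalQuot_record_four_seven`** — for any datum `(θ, y)` and any
  generators `l`: `u₀ ∈ 𝒪_{ℚ₇}ˣ`, `Φ : U(J₃(u₀)) ≃* U(1 ⊗ H₀)` matching the hyperspecial subgroups, a star-fixed
  uniformiser `ϖ'` of `𝒪_{ℚ₇(i)}`, and every irreducible `K_{(7)}`-finite representation of `U(1 ⊗ H₀)` with non-zero
  finite-dimensional `K_{(7)}`-invariants `≅ (inertSphericalQuot (α · (7²)⁻¹)) ∘ Φ⁻¹` for some `α ≠ 0`;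
* **`…_record_four_seven_zeta`** — the same with the explicit datum `(θ, y) = (−1, ζ₄)`.

`[Fact (Nat.Prime 7)]` is a section instance (inhabited by file 259's `fact_prime_seven`, a `Prop`). §8(d): uses an
L-value-free non-vanishing device: NO.
-/

open Matrix NumberField NumberField.IsCMField IsDedekindDomain IsDedekindDomain.HeightOneSpectrum Module
  MulAction
open scoped TensorProduct Pointwise
open Summit.Ventures.HodgeRepro2.T5UnitaryGroupForm Summit.Ventures.HodgeRepro2.T5UnitaryHeckeAdjoint
  Summit.Ventures.HodgeRepro2.T5HeckePermutationModule Summit.Ventures.HodgeRepro2.LevelPositivity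
  Summit.Ventures.HodgeRepro2.T5LevelIdempotent Summit.Ventures.HodgeRepro2.T5StarOfInvolution
  Summit.Ventures.HodgeRepro2.T5FinitePlaceCM Summit.Ventures.HodgeRepro2.T5NonSplitPlaceUnitaryGroup
  Summit.Ventures.HodgeRepro2.T5RecordHyperspecial Summit.Ventures.HodgeRepro2.T5GlobalLatticeAlmostAll
  Summit.Ventures.HodgeRepro2.T5HermitianThreeElements Summit.Ventures.HodgeRepro2.T5GaloisCartanThree
  Summit.Ventures.HodgeRepro2.T5InertDegreeGalois Summit.Ventures.HodgeRepro2.T5InertPlaceCompletion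
  Summit.Ventures.HodgeRepro2.T5InertDegreeAdicCompletion Summit.Ventures.HodgeRepro2.T5InertSatakeTransform
  Summit.Ventures.HodgeRepro2.T5InertSatakeTransformCompletion Summit.Ventures.HodgeRepro2.T5InertUnipotentResidue
  Summit.Ventures.HodgeRepro2.T5InertSphericalSubquotient Summit.Ventures.HodgeRepro2.T5RecordSatakeCell
  Summit.Ventures.HodgeRepro2.T5SplitPlaceUnitaryGroup Summit.Ventures.HodgeRepro2.T5FinitePlaceNormIndex
  Summit.Ventures.HodgeRepro2.T5HermitianLocalIsotropyN3 Summit.Ventures.HodgeRepro2.T5FinitePlaceSplitClassification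
  Summit.Ventures.HodgeRepro2.T5InertDegreeCompletion Summit.Ventures.HodgeRepro2.T5InertPlaceCompletionCells
  Summit.Ventures.HodgeRepro2.T5RecordSatake Summit.Ventures.HodgeRepro2.T5CartanCellsDistinct
  Summit.Ventures.HodgeRepro2.T5RecordSatakeInert Summit.Ventures.HodgeRepro2.T5InertGlobalPrime
  Summit.Ventures.HodgeRepro2.T5CMFieldSquareDatum Summit.Ventures.HodgeRepro2.T5RecordSatakeDegree
  Summit.Ventures.HodgeRepro2.T5RecordSatakeDegreeIntrinsic Summit.Ventures.HodgeRepro2.T5RecordSphericalSpectrum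
  Summit.Ventures.HodgeRepro2.T5RecordSphericalSpectrumIntrinsic Summit.Ventures.HodgeRepro2.T5RecordSatakeToy
  Summit.Ventures.HodgeRepro2.T5RecordSatakeInertToy Summit.Ventures.HodgeRepro2.T5RecordSatakeInertToyDegree
  Summit.Ventures.HodgeRepro2.T5CMCensusToy Summit.Ventures.HodgeRepro2.T5RecordSphericalSpectrumInertToy
  Summit.Ventures.HodgeRepro2.T5CyclotomicFourInertPrime
  Summit.Ventures.HodgeRepro2.T5RecordSphericalSpectrumFourInertPrime

namespace Summit.Ventures.HodgeRepro2.T5RecordSphericalSpectrumFourSeven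

universe uV

section Seven

variable (L : Type*) [Field L] [CharZero L] [IsCyclotomicExtension {2 ^ 2} ℚ L] [NumberField L] [IsCMField L]
variable [Fact (Nat.Prime 7)]
variable {θ : maximalRealSubfield L} {y : L}
  (hθ : algebraMap (maximalRealSubfield L) L θ = y ^ 2) (hy : complexConj L y ≠ y)
variable {r : ℕ} (l : Fin r → 𝓞 L) (k : Type*) [Field k] [CharZero k] [IsAlgClosed k]

omit [IsCMField L] [CharZero k] [IsAlgClosed k] in
/-- `N(vPrime 7) = 7` read in any field `k` (file 259's `absNorm_vPrime_seven`). -/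
theorem absNorm_vPrime_seven_cast :
    (Ideal.absNorm (vPrime L 7 orderOf_natCast_seven_zmod_four).asIdeal : k) = 7 := by
  have h : Ideal.absNorm (vPrime L 7 orderOf_natCast_seven_zmod_four).asIdeal = 7 := absNorm_vPrime_seven L
  rw [h]
  norm_num

include hθ hy in
/-- **THE UNRAMIFIED SPECTRUM ON `ℚ(i)` AT THE INERT PLACE `(7)`, `q = 7`**: the Satake parameter reads
`α · (7²)⁻¹ = α / 49`. -/
theorem exists_mulEquiv_forall_nonempty_equiv_inertSphericalQuot_record_four_seven
    (hl : Submodule.span (𝓞 (maximalRealSubfield L)) (Set.range l) = ⊤) :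
    letI := tensorStarRing L (vPrime L 7 orderOf_natCast_seven_zmod_four)
    letI := starRingOfQuadratic (finrank_eq_two L (vPrime L 7 orderOf_natCast_seven_zmod_four) (wPrime L 7 orderOf_natCast_seven_zmod_four) hθ hy
        (not_isSquare_of_staysPrime L (vPrime L 7 orderOf_natCast_seven_zmod_four) (wPrime L 7 orderOf_natCast_seven_zmod_four) hθ hy (map_vPrime L 7 orderOf_natCast_seven_zmod_four)))
      (localConj (vPrime L 7 orderOf_natCast_seven_zmod_four) (wPrime L 7 orderOf_natCast_seven_zmod_four) hθ.symm (span_pair_eq_top L hy)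
        (not_isSquare_of_staysPrime L (vPrime L 7 orderOf_natCast_seven_zmod_four) (wPrime L 7 orderOf_natCast_seven_zmod_four) hθ hy (map_vPrime L 7 orderOf_natCast_seven_zmod_four))
        (complexConj L))
      (localConj_ne_one (vPrime L 7 orderOf_natCast_seven_zmod_four) (wPrime L 7 orderOf_natCast_seven_zmod_four) hθ.symm (span_pair_eq_top L hy)
        (not_isSquare_of_staysPrime L (vPrime L 7 orderOf_natCast_seven_zmod_four) (wPrime L 7 orderOf_natCast_seven_zmod_four) hθ hy (map_vPrime L 7 orderOf_natCast_seven_zmod_four))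
        (complexConj L) (complexConj_apply_eq_neg L hθ hy))
    haveI := isDiscreteValuationRing_integralClosure_adicCompletion (vPrime L 7 orderOf_natCast_seven_zmod_four) (wPrime L 7 orderOf_natCast_seven_zmod_four)
    haveI := finite_residueField_integralClosure_adicCompletion (vPrime L 7 orderOf_natCast_seven_zmod_four) (wPrime L 7 orderOf_natCast_seven_zmod_four)
    haveI : IsFractionRing (integralClosure ((vPrime L 7 orderOf_natCast_seven_zmod_four).adicCompletionIntegers (maximalRealSubfield L))
        ((wPrime L 7 orderOf_natCast_seven_zmod_four).adicCompletion L)) ((wPrime L 7 orderOf_natCast_seven_zmod_four).adicCompletion L) :=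
      integralClosure.isFractionRing_of_finite_extension ((vPrime L 7 orderOf_natCast_seven_zmod_four).adicCompletion (maximalRealSubfield L))
        ((wPrime L 7 orderOf_natCast_seven_zmod_four).adicCompletion L)
    ∃ (u₀ : ((vPrime L 7 orderOf_natCast_seven_zmod_four).adicCompletionIntegers (maximalRealSubfield L))ˣ)
      (Φ : ↥(formUnitaryGroup (J3 (algebraMap ((vPrime L 7 orderOf_natCast_seven_zmod_four).adicCompletionIntegers (maximalRealSubfield L))
        ((wPrime L 7 orderOf_natCast_seven_zmod_four).adicCompletion L)
        (u₀ : (vPrime L 7 orderOf_natCast_seven_zmod_four).adicCompletionIntegers (maximalRealSubfield L))))) ≃*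
        ↥(formUnitaryGroup (tensorGram L (vPrime L 7 orderOf_natCast_seven_zmod_four) (gramToy L))))
      (ϖ' : integralClosure ((vPrime L 7 orderOf_natCast_seven_zmod_four).adicCompletionIntegers (maximalRealSubfield L))
        ((wPrime L 7 orderOf_natCast_seven_zmod_four).adicCompletion L))
      (hϖ' : Irreducible ϖ')
      (hs' : star (algebraMap (integralClosure ((vPrime L 7 orderOf_natCast_seven_zmod_four).adicCompletionIntegers (maximalRealSubfield L))
        ((wPrime L 7 orderOf_natCast_seven_zmod_four).adicCompletion L)) ((wPrime L 7 orderOf_natCast_seven_zmod_four).adicCompletion L) ϖ') =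
          algebraMap (integralClosure ((vPrime L 7 orderOf_natCast_seven_zmod_four).adicCompletionIntegers (maximalRealSubfield L))
            ((wPrime L 7 orderOf_natCast_seven_zmod_four).adicCompletion L)) ((wPrime L 7 orderOf_natCast_seven_zmod_four).adicCompletion L) ϖ'),
      (∀ g, g ∈ hyperspecialSubgroup
          (integralClosure ((vPrime L 7 orderOf_natCast_seven_zmod_four).adicCompletionIntegers (maximalRealSubfield L))
            ((wPrime L 7 orderOf_natCast_seven_zmod_four).adicCompletion L))
          (J3 (algebraMap ((vPrime L 7 orderOf_natCast_seven_zmod_four).adicCompletionIntegers (maximalRealSubfield L))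
            ((wPrime L 7 orderOf_natCast_seven_zmod_four).adicCompletion L)
            (u₀ : (vPrime L 7 orderOf_natCast_seven_zmod_four).adicCompletionIntegers (maximalRealSubfield L)))) ↔
          Φ g ∈ recordHyperspecial L (vPrime L 7 orderOf_natCast_seven_zmod_four) l (gramToy L)) ∧
      ∀ {V : Type uV} [AddCommGroup V] [Module k V]
        (ρ : Representation k (↥(formUnitaryGroup (tensorGram L (vPrime L 7 orderOf_natCast_seven_zmod_four) (gramToy L)))) V) [ρ.IsIrreducible],
        KFinite ρ (recordHyperspecial L (vPrime L 7 orderOf_natCast_seven_zmod_four) l (gramToy L)) →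
        ∀ [FiniteDimensional k (invariants ρ (recordHyperspecial L (vPrime L 7 orderOf_natCast_seven_zmod_four) l (gramToy L)))],
        invariants ρ (recordHyperspecial L (vPrime L 7 orderOf_natCast_seven_zmod_four) l (gramToy L)) ≠ ⊥ →
        ∃ α : k, α ≠ 0 ∧ Nonempty (ρ.Equiv (comp Φ.symm
          (inertSphericalQuot
            (hstar_of_star_eq (localConj (vPrime L 7 orderOf_natCast_seven_zmod_four) (wPrime L 7 orderOf_natCast_seven_zmod_four) hθ.symm (span_pair_eq_top L hy)
              (not_isSquare_of_staysPrime L (vPrime L 7 orderOf_natCast_seven_zmod_four) (wPrime L 7 orderOf_natCast_seven_zmod_four) hθ hy (map_vPrime L 7 orderOf_natCast_seven_zmod_four))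
              (complexConj L))
              (fun x => by
                rw [star_p8_eq_star L (vPrime L 7 orderOf_natCast_seven_zmod_four) (wPrime L 7 orderOf_natCast_seven_zmod_four) hθ hy
                  (not_isSquare_of_staysPrime L (vPrime L 7 orderOf_natCast_seven_zmod_four) (wPrime L 7 orderOf_natCast_seven_zmod_four) hθ hy
                    (map_vPrime L 7 orderOf_natCast_seven_zmod_four))]
                rfl))
            (algebraMap ((vPrime L 7 orderOf_natCast_seven_zmod_four).adicCompletionIntegers (maximalRealSubfield L))
              ((wPrime L 7 orderOf_natCast_seven_zmod_four).adicCompletion L)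
              (u₀ : (vPrime L 7 orderOf_natCast_seven_zmod_four).adicCompletionIntegers (maximalRealSubfield L)))
            (star_algebraMap_of_star_eq (localConj (vPrime L 7 orderOf_natCast_seven_zmod_four) (wPrime L 7 orderOf_natCast_seven_zmod_four) hθ.symm
              (span_pair_eq_top L hy)
              (not_isSquare_of_staysPrime L (vPrime L 7 orderOf_natCast_seven_zmod_four) (wPrime L 7 orderOf_natCast_seven_zmod_four) hθ hy (map_vPrime L 7 orderOf_natCast_seven_zmod_four))
              (complexConj L))
              (fun x => by
                rw [star_p8_eq_star L (vPrime L 7 orderOf_natCast_seven_zmod_four) (wPrime L 7 orderOf_natCast_seven_zmod_four) hθ hy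
                  (not_isSquare_of_staysPrime L (vPrime L 7 orderOf_natCast_seven_zmod_four) (wPrime L 7 orderOf_natCast_seven_zmod_four) hθ hy
                    (map_vPrime L 7 orderOf_natCast_seven_zmod_four))]
                rfl)
              (u₀ : (vPrime L 7 orderOf_natCast_seven_zmod_four).adicCompletionIntegers (maximalRealSubfield L)))
            (algebraMap_unit_ne_zero (F := (vPrime L 7 orderOf_natCast_seven_zmod_four).adicCompletion (maximalRealSubfield L)) u₀)
            (isInteger_algebraMap (u₀ : (vPrime L 7 orderOf_natCast_seven_zmod_four).adicCompletionIntegers (maximalRealSubfield L)))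
            (isInteger_algebraMap_unit_inv u₀) hϖ' hs' k (α * ((7 : k) ^ 2)⁻¹)))) :=
  exists_mulEquiv_forall_nonempty_equiv_inertSphericalQuot_record_of_staysPrime L (vPrime L 7 orderOf_natCast_seven_zmod_four)
    (wPrime L 7 orderOf_natCast_seven_zmod_four) hθ hy (map_vPrime L 7 orderOf_natCast_seven_zmod_four) l k 7 (absNorm_vPrime_seven_cast L k) hl
    gramToy_isHermitian isUnit_det_gramToy (notMem_badSet_gramToy _)

/-- **THE SAME AT `(7)` WITH THE EXPLICIT DATUM `(−1, ζ₄)`**: every `K_{(7)}`-spherical irreducible of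
`(U(1 ⊗ H₀), K_{(7)})` on `ℚ(i)` is `≅ (inertSphericalQuot (α · (7²)⁻¹)) ∘ Φ⁻¹` for some `α ≠ 0`. -/
theorem exists_mulEquiv_forall_nonempty_equiv_inertSphericalQuot_record_four_seven_zeta
    (hl : Submodule.span (𝓞 (maximalRealSubfield L)) (Set.range l) = ⊤) :
    letI := tensorStarRing L (vPrime L 7 orderOf_natCast_seven_zmod_four)
    letI := starRingOfQuadratic (finrank_eq_two L (vPrime L 7 orderOf_natCast_seven_zmod_four) (wPrime L 7 orderOf_natCast_seven_zmod_four) (neg_one_eq_zeta_sq L) (complexConj_zeta_ne L)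
        (not_isSquare_of_staysPrime L (vPrime L 7 orderOf_natCast_seven_zmod_four) (wPrime L 7 orderOf_natCast_seven_zmod_four) (neg_one_eq_zeta_sq L) (complexConj_zeta_ne L) (map_vPrime L 7 orderOf_natCast_seven_zmod_four)))
      (localConj (vPrime L 7 orderOf_natCast_seven_zmod_four) (wPrime L 7 orderOf_natCast_seven_zmod_four) (neg_one_eq_zeta_sq L).symm (span_pair_eq_top L (complexConj_zeta_ne L))
        (not_isSquare_of_staysPrime L (vPrime L 7 orderOf_natCast_seven_zmod_four) (wPrime L 7 orderOf_natCast_seven_zmod_four) (neg_one_eq_zeta_sq L) (complexConj_zeta_ne L) (map_vPrime L 7 orderOf_natCast_seven_zmod_four))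
        (complexConj L))
      (localConj_ne_one (vPrime L 7 orderOf_natCast_seven_zmod_four) (wPrime L 7 orderOf_natCast_seven_zmod_four) (neg_one_eq_zeta_sq L).symm (span_pair_eq_top L (complexConj_zeta_ne L))
        (not_isSquare_of_staysPrime L (vPrime L 7 orderOf_natCast_seven_zmod_four) (wPrime L 7 orderOf_natCast_seven_zmod_four) (neg_one_eq_zeta_sq L) (complexConj_zeta_ne L) (map_vPrime L 7 orderOf_natCast_seven_zmod_four))
        (complexConj L) (complexConj_apply_eq_neg L (neg_one_eq_zeta_sq L) (complexConj_zeta_ne L)))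
    haveI := isDiscreteValuationRing_integralClosure_adicCompletion (vPrime L 7 orderOf_natCast_seven_zmod_four) (wPrime L 7 orderOf_natCast_seven_zmod_four)
    haveI := finite_residueField_integralClosure_adicCompletion (vPrime L 7 orderOf_natCast_seven_zmod_four) (wPrime L 7 orderOf_natCast_seven_zmod_four)
    haveI : IsFractionRing (integralClosure ((vPrime L 7 orderOf_natCast_seven_zmod_four).adicCompletionIntegers (maximalRealSubfield L))
        ((wPrime L 7 orderOf_natCast_seven_zmod_four).adicCompletion L)) ((wPrime L 7 orderOf_natCast_seven_zmod_four).adicCompletion L) :=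
      integralClosure.isFractionRing_of_finite_extension ((vPrime L 7 orderOf_natCast_seven_zmod_four).adicCompletion (maximalRealSubfield L))
        ((wPrime L 7 orderOf_natCast_seven_zmod_four).adicCompletion L)
    ∃ (u₀ : ((vPrime L 7 orderOf_natCast_seven_zmod_four).adicCompletionIntegers (maximalRealSubfield L))ˣ)
      (Φ : ↥(formUnitaryGroup (J3 (algebraMap ((vPrime L 7 orderOf_natCast_seven_zmod_four).adicCompletionIntegers (maximalRealSubfield L))
        ((wPrime L 7 orderOf_natCast_seven_zmod_four).adicCompletion L)
        (u₀ : (vPrime L 7 orderOf_natCast_seven_zmod_four).adicCompletionIntegers (maximalRealSubfield L))))) ≃*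
        ↥(formUnitaryGroup (tensorGram L (vPrime L 7 orderOf_natCast_seven_zmod_four) (gramToy L))))
      (ϖ' : integralClosure ((vPrime L 7 orderOf_natCast_seven_zmod_four).adicCompletionIntegers (maximalRealSubfield L))
        ((wPrime L 7 orderOf_natCast_seven_zmod_four).adicCompletion L))
      (hϖ' : Irreducible ϖ')
      (hs' : star (algebraMap (integralClosure ((vPrime L 7 orderOf_natCast_seven_zmod_four).adicCompletionIntegers (maximalRealSubfield L))
        ((wPrime L 7 orderOf_natCast_seven_zmod_four).adicCompletion L)) ((wPrime L 7 orderOf_natCast_seven_zmod_four).adicCompletion L) ϖ') =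
          algebraMap (integralClosure ((vPrime L 7 orderOf_natCast_seven_zmod_four).adicCompletionIntegers (maximalRealSubfield L))
            ((wPrime L 7 orderOf_natCast_seven_zmod_four).adicCompletion L)) ((wPrime L 7 orderOf_natCast_seven_zmod_four).adicCompletion L) ϖ'),
      (∀ g, g ∈ hyperspecialSubgroup
          (integralClosure ((vPrime L 7 orderOf_natCast_seven_zmod_four).adicCompletionIntegers (maximalRealSubfield L))
            ((wPrime L 7 orderOf_natCast_seven_zmod_four).adicCompletion L))
          (J3 (algebraMap ((vPrime L 7 orderOf_natCast_seven_zmod_four).adicCompletionIntegers (maximalRealSubfield L))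
            ((wPrime L 7 orderOf_natCast_seven_zmod_four).adicCompletion L)
            (u₀ : (vPrime L 7 orderOf_natCast_seven_zmod_four).adicCompletionIntegers (maximalRealSubfield L)))) ↔
          Φ g ∈ recordHyperspecial L (vPrime L 7 orderOf_natCast_seven_zmod_four) l (gramToy L)) ∧
      ∀ {V : Type uV} [AddCommGroup V] [Module k V]
        (ρ : Representation k (↥(formUnitaryGroup (tensorGram L (vPrime L 7 orderOf_natCast_seven_zmod_four) (gramToy L)))) V) [ρ.IsIrreducible],
        KFinite ρ (recordHyperspecial L (vPrime L 7 orderOf_natCast_seven_zmod_four) l (gramToy L)) →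
        ∀ [FiniteDimensional k (invariants ρ (recordHyperspecial L (vPrime L 7 orderOf_natCast_seven_zmod_four) l (gramToy L)))],
        invariants ρ (recordHyperspecial L (vPrime L 7 orderOf_natCast_seven_zmod_four) l (gramToy L)) ≠ ⊥ →
        ∃ α : k, α ≠ 0 ∧ Nonempty (ρ.Equiv (comp Φ.symm
          (inertSphericalQuot
            (hstar_of_star_eq (localConj (vPrime L 7 orderOf_natCast_seven_zmod_four) (wPrime L 7 orderOf_natCast_seven_zmod_four) (neg_one_eq_zeta_sq L).symm (span_pair_eq_top L (complexConj_zeta_ne L))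
              (not_isSquare_of_staysPrime L (vPrime L 7 orderOf_natCast_seven_zmod_four) (wPrime L 7 orderOf_natCast_seven_zmod_four) (neg_one_eq_zeta_sq L) (complexConj_zeta_ne L) (map_vPrime L 7 orderOf_natCast_seven_zmod_four))
              (complexConj L))
              (fun x => by
                rw [star_p8_eq_star L (vPrime L 7 orderOf_natCast_seven_zmod_four) (wPrime L 7 orderOf_natCast_seven_zmod_four) (neg_one_eq_zeta_sq L) (complexConj_zeta_ne L)
                  (not_isSquare_of_staysPrime L (vPrime L 7 orderOf_natCast_seven_zmod_four) (wPrime L 7 orderOf_natCast_seven_zmod_four) (neg_one_eq_zeta_sq L) (complexConj_zeta_ne L)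
                    (map_vPrime L 7 orderOf_natCast_seven_zmod_four))]
                rfl))
            (algebraMap ((vPrime L 7 orderOf_natCast_seven_zmod_four).adicCompletionIntegers (maximalRealSubfield L))
              ((wPrime L 7 orderOf_natCast_seven_zmod_four).adicCompletion L)
              (u₀ : (vPrime L 7 orderOf_natCast_seven_zmod_four).adicCompletionIntegers (maximalRealSubfield L)))
            (star_algebraMap_of_star_eq (localConj (vPrime L 7 orderOf_natCast_seven_zmod_four) (wPrime L 7 orderOf_natCast_seven_zmod_four) (neg_one_eq_zeta_sq L).symm
              (span_pair_eq_top L (complexConj_zeta_ne L))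
              (not_isSquare_of_staysPrime L (vPrime L 7 orderOf_natCast_seven_zmod_four) (wPrime L 7 orderOf_natCast_seven_zmod_four) (neg_one_eq_zeta_sq L) (complexConj_zeta_ne L) (map_vPrime L 7 orderOf_natCast_seven_zmod_four))
              (complexConj L))
              (fun x => by
                rw [star_p8_eq_star L (vPrime L 7 orderOf_natCast_seven_zmod_four) (wPrime L 7 orderOf_natCast_seven_zmod_four) (neg_one_eq_zeta_sq L) (complexConj_zeta_ne L)
                  (not_isSquare_of_staysPrime L (vPrime L 7 orderOf_natCast_seven_zmod_four) (wPrime L 7 orderOf_natCast_seven_zmod_four) (neg_one_eq_zeta_sq L) (complexConj_zeta_ne L)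
                    (map_vPrime L 7 orderOf_natCast_seven_zmod_four))]
                rfl)
              (u₀ : (vPrime L 7 orderOf_natCast_seven_zmod_four).adicCompletionIntegers (maximalRealSubfield L)))
            (algebraMap_unit_ne_zero (F := (vPrime L 7 orderOf_natCast_seven_zmod_four).adicCompletion (maximalRealSubfield L)) u₀)
            (isInteger_algebraMap (u₀ : (vPrime L 7 orderOf_natCast_seven_zmod_four).adicCompletionIntegers (maximalRealSubfield L)))
            (isInteger_algebraMap_unit_inv u₀) hϖ' hs' k (α * ((7 : k) ^ 2)⁻¹)))) :=
  exists_mulEquiv_forall_nonempty_equiv_inertSphericalQuot_record_four_seven L (neg_one_eq_zeta_sq L)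
    (complexConj_zeta_ne L) l k hl

end Seven

end Summit.Ventures.HodgeRepro2.T5RecordSphericalSpectrumFourSeven
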